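import Literature.NumberTheory.LFunctions.MoebiusWalshTypeIEstimate
import Literature.NumberTheory.LFunctions.LiouvilleWalshBoxCriterion
import HarnessLib

/-!
# The type-I box bounds of Bourgain 2013, §3, in per-box form — proved

Topic `Literature/NumberTheory/LFunctions`; proofs-only (theorems, no definition, no named fact).
For the dyadic type-I box sums `boxSum T i j c 1 = ∑_{a ∈ D_i} c(a) ∑_{b ∈ D_j} w_T(ab)`
(`|c| ≤ τ`) produced by the Vaughan reductions of the tree
(`MoebiusWalshVaughan.abs_walshSum_moebius_le_boxes`, `LiouvilleWalshVaughan.abs_walshSum_liouville_le_boxes`),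
this file packages the three regimes of §3 of J. Bourgain, *Möbius–Walsh correlation bounds and
an estimate of Mauduit and Rivat*, J. Anal. Math. **119** (2013) 147–163 (= arXiv:1109.2784)
[Bourgain2013MoebiusWalsh] as bounds `|box| ≤ 2^{i+j} · 2(i+2)² · √Y` with an explicit small `Y`:

* `abs_boxSum_divisorBounded_le_of_sum_abs` — Cauchy–Schwarz (tree:
  `LiouvilleWalsh.abs_boxSum_le_sqrt_of_divisorBounded`): `∑_a |∑_b w_T(ab)| ≤ 2^{i+j} Y` gives
  `|boxSum T i j c 1| ≤ 2^{i+j} · 2(i+2)² · √Y`;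
* `sum_abs_le_crude` — (3.2')–(3.3), from `MoebiusWalsh.typeI_crude` with `Λ = i + j + 2`:
  `Y = 8(Λ+2) 2^i η_T`, `η_T = 2·2^{-c₂|T|}` (relative saving `≍ M 2^{-c|T|}`);
* `sum_abs_le_refined` — (3.5)–(3.9), from `MoebiusWalsh.typeI_refined` (cut at `j - i`):
  `Y = 2Λ (2Λ)^{|T₂|} η_{T₁}`, `T₁ = T ∩ [0, j-i)`, `T₂ = T ∩ [j-i, Λ)`, and `refined_saving_le`:
  if `2Λ ≤ 2^b` and `b|T₂| ≤ c₂|T|/4` then `(2Λ)^{|T₂|} η_{T₁} ≤ 2·2^{-c₂|T|/2}` (the printed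
  hypothesis (3.4), "`max |S ∩ J| < CH`");
* `sum_abs_eq_boxSum_sign` — `∑_a |∑_b w_T(ab)| = boxSum T i j ε 1` with signs `|ε| ≤ 1`, so that
  in the remaining case ((2.35): a top window is heavy) any TYPE-II bound for the box applies
  (`abs_boxSum_divisorBounded_le_of_typeII`).

## References

* J. Bourgain, J. Anal. Math. 119 (2013) 147–163, §3 (3.1)–(3.4), (3.8)–(3.9); §2 (2.35).
  [Bourgain2013MoebiusWalsh]
-/

noncomputable section

open Finset Real
open scoped ArithmeticFunction.sigma

namespace Literature.NumberTheory.LFunctions.MoebiusWalshTypeII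

open Literature.NumberTheory.LFunctions.MoebiusWalshVaughan (natWalsh dyBlock mem_dyBlock boxSum
  abs_natWalsh_le)
open Literature.NumberTheory.LFunctions.MoebiusWalsh (walshSupExponent walshSupExponent_pos
  typeI_crude typeI_refined)
open Literature.NumberTheory.LFunctions.LiouvilleWalsh (abs_boxSum_le_sqrt_of_divisorBounded)

/-! ### The exponent of Lemma 2 is at most `1` -/

/-- `c₂ = log₂(27/16)/4 ≤ 1` (indeed `< 1/4`). [folklore] -/
theorem walshSupExponent_le_one : walshSupExponent ≤ 1 := by
  unfold walshSupExponent
  have h : Real.logb 2 (27 / 16) ≤ Real.logb 2 2 :=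
    Real.logb_le_logb_of_le one_lt_two (by norm_num) (by norm_num)
  rw [Real.logb_self_eq_one one_lt_two] at h
  linarith

/-! ### From a bound for `∑_a |∑_b w_T(ab)|` to the type-I box -/

/-- **Cauchy–Schwarz for the type-I box, normalised.** For `|c| ≤ τ` and
`∑_{a ∈ D_i} |∑_{b ∈ D_j} w_T(ab)| ≤ 2^{i+j} Y` (`Y ≥ 0`):
`|boxSum T i j c 1| ≤ 2^{i+j} · 2(i+2)² · √Y`
(`√(2^{i+1}(1 + log 2^{i+1})³) √(2^j · 2^{i+j} Y) = 2^{i+j} √(2(1 + log 2^{i+1})³ Y)` and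
`1 + log 2^{i+1} ≤ i + 2`, `2(i+2)³ ≤ 4(i+2)⁴`). [cite: Bourgain2013MoebiusWalsh, §3 (3.1)] -/
theorem abs_boxSum_divisorBounded_le_of_sum_abs (T : Finset ℕ) (i j : ℕ) {c : ℕ → ℝ}
    (hc : ∀ a, |c a| ≤ (σ 0 a : ℝ)) {Y : ℝ} (hY : 0 ≤ Y)
    (hF : ∑ a ∈ dyBlock i, |∑ b ∈ dyBlock j, natWalsh T (a * b)| ≤ 2 ^ (i + j) * Y) :
    |boxSum T i j c (fun _ => 1)| ≤ 2 ^ (i + j) * (2 * ((i : ℝ) + 2) ^ 2) * Real.sqrt Y := by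
  have h := abs_boxSum_le_sqrt_of_divisorBounded T i j hc hF
  refine h.trans ?_
  set X : ℝ := 1 + Real.log ((2 : ℝ) ^ (i + 1)) with hX
  have hX0 : 0 ≤ X := by
    have := Real.log_nonneg (one_le_pow₀ (M₀ := ℝ) one_le_two (n := i + 1)); rw [hX]; linarith
  have hXle : X ≤ (i : ℝ) + 2 := by
    rw [hX, Real.log_pow]
    have h2 : Real.log 2 ≤ 1 := by have := Real.log_two_lt_d9; linarith
    have : ((i + 1 : ℕ) : ℝ) * Real.log 2 ≤ (i + 1 : ℕ) := by
      have := mul_le_mul_of_nonneg_left h2 (Nat.cast_nonneg (i + 1)); simpa using this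
    push_cast at this ⊢; linarith
  rw [← Real.sqrt_mul (by positivity)]
  have hprod : (2 : ℝ) ^ (i + 1) * X ^ 3 * (2 ^ j * (2 ^ (i + j) * Y)) =
      ((2 : ℝ) ^ (i + j)) ^ 2 * (2 * X ^ 3 * Y) := by
    rw [pow_add, pow_add]; ring
  rw [hprod, Real.sqrt_mul (by positivity), Real.sqrt_sq (by positivity)]
  have hin : 2 * X ^ 3 * Y ≤ (2 * ((i : ℝ) + 2) ^ 2) ^ 2 * Y := by
    refine mul_le_mul_of_nonneg_right ?_ hY
    have h1 : X ^ 3 ≤ ((i : ℝ) + 2) ^ 3 := pow_le_pow_left₀ hX0 hXle 3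
    have h2 : (0 : ℝ) ≤ (i : ℝ) := Nat.cast_nonneg i
    nlinarith
  calc (2 : ℝ) ^ (i + j) * Real.sqrt (2 * X ^ 3 * Y)
      ≤ 2 ^ (i + j) * Real.sqrt ((2 * ((i : ℝ) + 2) ^ 2) ^ 2 * Y) := by gcongr
    _ = 2 ^ (i + j) * (2 * ((i : ℝ) + 2) ^ 2) * Real.sqrt Y := by
        rw [Real.sqrt_mul (by positivity), Real.sqrt_sq (by positivity)]; ring

/-! ### The sum of absolute values as a box sum with sign coefficients -/

/-- `∑_a |∑_b w_T(ab)| = boxSum T i j ε 1` for the signs `ε(a) = ±1` of the inner sums.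
[cite: Bourgain2013MoebiusWalsh, §2 (2.1) (type-I sums as type-II sums with β = 1)] -/
theorem sum_abs_eq_boxSum_sign (T : Finset ℕ) (i j : ℕ) :
    ∑ a ∈ dyBlock i, |∑ b ∈ dyBlock j, natWalsh T (a * b)| =
      boxSum T i j (fun a => if 0 ≤ ∑ b ∈ dyBlock j, natWalsh T (a * b) then 1 else -1)
        (fun _ => 1) := by
  unfold boxSum
  refine Finset.sum_congr rfl fun a _ => ?_
  rw [show ∑ b ∈ dyBlock j, (if 0 ≤ ∑ b ∈ dyBlock j, natWalsh T (a * b) then (1 : ℝ) else -1) *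
      (1 : ℝ) * natWalsh T (a * b) =
      (if 0 ≤ ∑ b ∈ dyBlock j, natWalsh T (a * b) then (1 : ℝ) else -1) *
        ∑ b ∈ dyBlock j, natWalsh T (a * b) by
    rw [Finset.mul_sum]; refine Finset.sum_congr rfl fun b _ => by ring]
  split_ifs with h
  · rw [abs_of_nonneg h, one_mul]
  · rw [abs_of_neg (not_le.1 h)]; ring

/-- The sign coefficients are bounded by `1`. [folklore] -/
theorem abs_sign_coeff_le_one (T : Finset ℕ) (j a : ℕ) :
    |(if 0 ≤ ∑ b ∈ dyBlock j, natWalsh T (a * b) then (1 : ℝ) else -1)| ≤ 1 := by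
  split_ifs <;> simp

/-- **Type-I box through a type-II bound** (Bourgain 2013, (2.35)): if every box sum with
coefficients of modulus `≤ 1` satisfies `boxSum T i j α 1 ≤ 2^{i+j} Y`, then for `|c| ≤ τ`,
`|boxSum T i j c 1| ≤ 2^{i+j} · 2(i+2)² · √Y`. [cite: Bourgain2013MoebiusWalsh, §2 (2.35), §3 (3.1)] -/
theorem abs_boxSum_divisorBounded_le_of_typeII (T : Finset ℕ) (i j : ℕ) {c : ℕ → ℝ}
    (hc : ∀ a, |c a| ≤ (σ 0 a : ℝ)) {Y : ℝ} (hY : 0 ≤ Y)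
    (hII : ∀ α : ℕ → ℝ, (∀ a, |α a| ≤ 1) → boxSum T i j α (fun _ => 1) ≤ 2 ^ (i + j) * Y) :
    |boxSum T i j c (fun _ => 1)| ≤ 2 ^ (i + j) * (2 * ((i : ℝ) + 2) ^ 2) * Real.sqrt Y := by
  refine abs_boxSum_divisorBounded_le_of_sum_abs T i j hc hY ?_
  rw [sum_abs_eq_boxSum_sign]
  exact hII _ (abs_sign_coeff_le_one T j)

/-! ### The crude regime (3.2')–(3.3) -/

/-- **Crude type-I bound, normalised**: for `T ⊆ [0, i+j+2)`,
`∑_{a ∈ D_i} |∑_{b ∈ D_j} w_T(ab)| ≤ 2^{i+j} · (8(i+j+4) 2^i η_T)`, `η_T = 2·2^{-c₂|T|}`.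
[cite: Bourgain2013MoebiusWalsh, §3 (3.2'), (3.3)] -/
theorem sum_abs_le_crude (T : Finset ℕ) {i j : ℕ} (hT : ∀ t ∈ T, t < i + j + 2) :
    ∑ a ∈ dyBlock i, |∑ b ∈ dyBlock j, natWalsh T (a * b)| ≤
      2 ^ (i + j) * (8 * ((i + j + 2 : ℕ) + 2 : ℝ) * 2 ^ i *
        (2 * (2 : ℝ) ^ (-(walshSupExponent * (T.card : ℝ))))) := by
  have h := typeI_crude T hT i j
  refine h.trans ?_
  set η : ℝ := 2 * (2 : ℝ) ^ (-(walshSupExponent * (T.card : ℝ))) with hη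
  set Λ := i + j + 2 with hΛ
  have hη0 : 0 ≤ η := by rw [hη]; positivity
  have hlog : 1 + Real.log ((2 : ℝ) ^ Λ) ≤ (Λ : ℝ) + 1 := by
    rw [Real.log_pow]
    have h2 : Real.log 2 ≤ 1 := by have := Real.log_two_lt_d9; linarith
    have : (Λ : ℝ) * Real.log 2 ≤ Λ := by
      have := mul_le_mul_of_nonneg_left h2 (Nat.cast_nonneg Λ); simpa using this
    linarith
  have hlog0 : 0 ≤ 1 + Real.log ((2 : ℝ) ^ Λ) := by
    have := Real.log_nonneg (one_le_pow₀ (M₀ := ℝ) one_le_two (n := Λ)); linarith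
  have hi : (i : ℝ) + 1 ≤ (2 : ℝ) ^ (i + 1) := by
    have := Nat.lt_two_pow_self (n := i + 1)
    exact_mod_cast this.le
  -- `2·2^j (i+1) 2^i + 2^i 2^Λ (1 + log 2^Λ) ≤ 2^{i+j} · 8(Λ+2) 2^i`
  have hmain : 2 * (2 : ℝ) ^ j * (((i : ℝ) + 1) * 2 ^ i) + 2 ^ i * (2 ^ Λ * (1 + Real.log ((2 : ℝ) ^ Λ))) ≤
      2 ^ (i + j) * (8 * ((Λ : ℝ) + 2) * 2 ^ i) := by
    set lg : ℝ := 1 + Real.log ((2 : ℝ) ^ Λ) with hlg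
    set A : ℝ := (2 : ℝ) ^ i with hA
    set B : ℝ := (2 : ℝ) ^ j with hB
    have hA0 : 0 < A := by positivity
    have hB0 : 0 < B := by positivity
    have hΛ2 : (2 : ℝ) ^ Λ = A * B * 4 := by rw [hΛ, pow_add, pow_add, ← hA, ← hB]; norm_num
    have h2i : (2 : ℝ) ^ (i + 1) = 2 * A := by rw [pow_succ, ← hA, mul_comm]
    rw [hΛ2, pow_add, ← hA, ← hB]
    rw [h2i] at hi
    have hΛ0 : (0 : ℝ) ≤ Λ := Nat.cast_nonneg Λ
    have h1 : A * B * ((i : ℝ) + 1) ≤ A * B * (2 * A) :=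
      mul_le_mul_of_nonneg_left hi (by positivity)
    have h2 : A * A * B * lg ≤ A * A * B * ((Λ : ℝ) + 1) :=
      mul_le_mul_of_nonneg_left hlog (by positivity)
    have h3 : 0 ≤ A * A * B * ((Λ : ℝ) + 2) := by positivity
    nlinarith
  calc η * (2 * (2 : ℝ) ^ j * (((i : ℝ) + 1) * 2 ^ i) + 2 ^ i * (2 ^ Λ * (1 + Real.log ((2 : ℝ) ^ Λ))))
      ≤ η * (2 ^ (i + j) * (8 * ((Λ : ℝ) + 2) * 2 ^ i)) := mul_le_mul_of_nonneg_left hmain hη0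
    _ = 2 ^ (i + j) * (8 * ((i + j + 2 : ℕ) + 2 : ℝ) * 2 ^ i * η) := by rw [hΛ]; ring

/-! ### The refined regime (3.5)–(3.9) -/

/-- **Refined type-I bound, normalised**: for `T ⊆ [0, Λ)`, `Λ = i+j+2`, `i ≤ j`, with
`T₁ = T ∩ [0, j-i)`, `T₂ = T ∩ [j-i, Λ)`:
`∑_{a ∈ D_i} |∑_{b ∈ D_j} w_T(ab)| ≤ 2^{i+j} · (2Λ (2Λ)^{|T₂|} η_{T₁})`, `η_{T₁} = 2·2^{-c₂|T₁|}`.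
[cite: Bourgain2013MoebiusWalsh, §3 (3.8)–(3.9)] -/
theorem sum_abs_le_refined (T : Finset ℕ) {i j : ℕ} (hT : ∀ t ∈ T, t < i + j + 2) (hij : i ≤ j) :
    ∑ a ∈ dyBlock i, |∑ b ∈ dyBlock j, natWalsh T (a * b)| ≤
      2 ^ (i + j) * (2 * ((i + j + 2 : ℕ) : ℝ) *
        (2 * ((i + j + 2 : ℕ) : ℝ)) ^ (T.filter fun t => ¬ t < j - i).card *
        (2 * (2 : ℝ) ^ (-(walshSupExponent * ((T.filter (· < j - i)).card : ℝ))))) := by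
  have h := typeI_refined T hT hij
  refine h.trans ?_
  set η : ℝ := 2 * (2 : ℝ) ^ (-(walshSupExponent * ((T.filter (· < j - i)).card : ℝ))) with hη
  set Λ := i + j + 2 with hΛ
  set P : ℝ := (2 * (Λ : ℝ)) ^ (T.filter fun t => ¬ t < j - i).card with hP
  have hη0 : 0 ≤ η := by rw [hη]; positivity
  have hP0 : 0 ≤ P := by rw [hP]; positivity
  have hlog : 1 + Real.log ((2 : ℝ) ^ (j - i)) ≤ (j : ℝ) + 1 := by
    rw [Real.log_pow]
    have h2 : Real.log 2 ≤ 1 := by have := Real.log_two_lt_d9; linarith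
    have h3 : ((j - i : ℕ) : ℝ) * Real.log 2 ≤ (j - i : ℕ) := by
      have := mul_le_mul_of_nonneg_left h2 (Nat.cast_nonneg (j - i)); simpa using this
    have h4 : ((j - i : ℕ) : ℝ) ≤ j := by exact_mod_cast Nat.sub_le j i
    linarith
  have hin : 2 * (((i : ℝ) + 1) * 2 ^ i) + (1 + Real.log ((2 : ℝ) ^ (j - i))) ≤ 2 ^ i * (2 * (Λ : ℝ)) := by
    have h1 : (1 : ℝ) ≤ 2 ^ i := one_le_pow₀ one_le_two
    have hΛR : (Λ : ℝ) = i + j + 2 := by rw [hΛ]; push_cast; ring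
    rw [hΛR]
    have hj0 : (0 : ℝ) ≤ j := Nat.cast_nonneg j
    nlinarith
  calc η * P * (2 ^ j * (2 * (((i : ℝ) + 1) * 2 ^ i) + (1 + Real.log ((2 : ℝ) ^ (j - i)))))
      ≤ η * P * (2 ^ j * (2 ^ i * (2 * (Λ : ℝ)))) := by gcongr
    _ = 2 ^ (i + j) * (2 * (Λ : ℝ) * P * η) := by rw [pow_add]; ring

/-- **The saving of the refined regime under (3.4).** With `T₁ = T ∩ [0,m)`, `T₂ = T ∩ [m, ∞)`,
if `2Λ ≤ 2^b` and `b |T₂| ≤ c₂ |T| / 4`, then `(2Λ)^{|T₂|} η_{T₁} ≤ 2·2^{-c₂|T|/2}`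
(`|T₁| = |T| - |T₂|`, `c₂ ≤ 1 ≤ b`). [cite: Bourgain2013MoebiusWalsh, §3 (3.4), (3.9)] -/
theorem refined_saving_le (T : Finset ℕ) (m : ℕ) {Λ b : ℕ} (hb : 2 * Λ ≤ 2 ^ b) (hb1 : 1 ≤ b)
    (hcond : (b : ℝ) * (T.filter fun t => ¬ t < m).card ≤ walshSupExponent * T.card / 4) :
    (2 * (Λ : ℝ)) ^ (T.filter fun t => ¬ t < m).card *
        (2 * (2 : ℝ) ^ (-(walshSupExponent * ((T.filter (· < m)).card : ℝ)))) ≤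
      2 * (2 : ℝ) ^ (-(walshSupExponent * T.card / 2)) := by
  set c₂ := walshSupExponent with hc₂
  have hc0 : 0 ≤ c₂ := walshSupExponent_pos.le
  have hc1 : c₂ ≤ 1 := walshSupExponent_le_one
  set n₁ : ℕ := (T.filter (· < m)).card with hn₁
  set n₂ : ℕ := (T.filter fun t => ¬ t < m).card with hn₂
  have hsum : (n₁ : ℝ) + n₂ = T.card := by
    rw [hn₁, hn₂]; exact_mod_cast Finset.card_filter_add_card_filter_not (· < m)
  -- `(2Λ)^{n₂} ≤ 2^{b n₂}`
  have hpow : (2 * (Λ : ℝ)) ^ n₂ ≤ (2 : ℝ) ^ ((b : ℝ) * n₂) := by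
    have h1 : (2 * (Λ : ℝ)) ≤ (2 : ℝ) ^ b := by exact_mod_cast hb
    calc (2 * (Λ : ℝ)) ^ n₂ ≤ ((2 : ℝ) ^ b) ^ n₂ := pow_le_pow_left₀ (by positivity) h1 n₂
      _ = (2 : ℝ) ^ ((b : ℝ) * n₂) := by
          rw [← pow_mul, ← Real.rpow_natCast]; push_cast; ring_nf
  have hexp : (b : ℝ) * n₂ + -(c₂ * n₁) ≤ -(c₂ * T.card / 2) := by
    have hb1' : (1 : ℝ) ≤ b := by exact_mod_cast hb1
    have hn20 : (0 : ℝ) ≤ n₂ := Nat.cast_nonneg n₂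
    have : c₂ * n₂ ≤ b * n₂ := mul_le_mul_of_nonneg_right (hc1.trans hb1') hn20
    nlinarith
  calc (2 * (Λ : ℝ)) ^ n₂ * (2 * (2 : ℝ) ^ (-(c₂ * n₁)))
      ≤ (2 : ℝ) ^ ((b : ℝ) * n₂) * (2 * (2 : ℝ) ^ (-(c₂ * n₁))) := by gcongr
    _ = 2 * ((2 : ℝ) ^ ((b : ℝ) * n₂) * (2 : ℝ) ^ (-(c₂ * n₁))) := by ring
    _ = 2 * (2 : ℝ) ^ ((b : ℝ) * n₂ + -(c₂ * n₁)) := by rw [← Real.rpow_add two_pos]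
    _ ≤ 2 * (2 : ℝ) ^ (-(c₂ * T.card / 2)) :=
        mul_le_mul_of_nonneg_left (Real.rpow_le_rpow_of_exponent_le one_le_two hexp) (by norm_num)

end Literature.NumberTheory.LFunctions.MoebiusWalshTypeII
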